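import Mathlib
import Literature.Computability.AlgebraicComplexity.NewtonPolygonTau
import Summits.ValiantsHypothesis.ValiantsHypothesis.Theses.NewtonUnitEquations
import Summits.ValiantsHypothesis.ValiantsHypothesis.Theorems.NewtonTauWeak.Negative.Zonogon
import Summits.ValiantsHypothesis.ValiantsHypothesis.Theorems.NewtonUnitEquationsNewtonTauWeakVdpDefs

/-!
# Line `euler-wronskian-vdp` for crux `NewtonUnitEquations.NewtonTauWeak` (stmt-ValiantsHypothesis-5904)
# — lead's reshaped skeleton (gen 1, cycle 1)

Crux (KPTT arXiv:1308.2286, Conj. 1 in the weak form of Thm 1): `V(Σ_{i<k} Π_{j<m} f_ij) ≤ 2^{am}(kt+2)^b`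
for `t`-sparse bivariate `f_ij` over `ℂ`, `V` = `newtonVertexCount` = number of vertices of the Newton
polygon (the crux's literal count, `rfl`).

## The line (crux-plan `Lines/euler_wronskian_vdp.lean` + card `Lines/euler-wronskian-vdp.md`)

Ultrametric Voorhoeve–van der Poorten: with the Euler derivation `θ = X∂_X + μY∂_Y` over the slope ring
`ℂ[μ]` (`θ X^e = (e₀ + μe₁) X^e`, lossless valuative Rolle) and the Euler–Wronskians `W(u_S) = det[θ^a u_b]`,
`V(Σ_i u_i) ≤ c(k+1)² · max_{S ⊆ [k]} V(W(u_S))` for EVERY finite family (`Vdp`); applied to the products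
`u_i = Π_j f_ij` the crux reduces to: Euler–Wronskians of `r ≥ 2` products of `m` `t`-nomials have
`≤ 2^{am}(rt+2)^b` vertices uniformly in `r` (`stub_wronskianWeak`, the residual, OPEN) plus Ostrowski for one
product (`stub_productVertices`).  Objects: `Theorems/NewtonUnitEquationsNewtonTauWeakVdpDefs.lean` (p96422).

## The reshape (lead, gen 1): `stub_vdp` needs no cone power series

The planner's `stub_vdp` (size L: cone-series rings, tropical functions on arcs) is replaced by a
finite-dimensional route, split into four worker stubs and the lead's assembly:

* LEADING TERM (`stub_leadingTermWronskian`): if `v_0,…,v_{r-1}` have pairwise distinct strict `w`-tops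
  `e_b`, then `W(v)` has strict `w`-top `Σ_b e_b` — multilinear expansion of `det[θ^a v_b]` over the supports;
  the top tuple is reached once, with coefficient `(Π_b coeff) · VdM(⟨ν,e_b⟩) ≠ 0` in the domain `ℂ[μ]`
  (`eulerWeight` injective, `Matrix.det_vandermonde`).
* STRUCTURE (`stub_vdpStructure`, from the leading-term statement): for a ℂ-independent family `u` and a
  generic weight `w`, the top of `s = Σ_i u_i` satisfies `top s + top W_j = top W_{j+1}` for some flag pair
  (`W_j = flagW u j = W(u_0..u_{j-1})`).  Proof: min-top representatives `ũ_i ∈ u_i + span(u_{<i})` have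
  pairwise distinct tops (a shared top can be cancelled inside the coset), `W(ũ_{<j}) = W(u_{<j})`
  (unipotent column operations), so `top W_j = Σ_{i<j} top ũ_i` by the leading-term statement; either
  `top s = top ũ_i` for some `i < k-1` (then `j = i`), or the family `(ũ_0,…,ũ_{k-2}, s)` has distinct tops and
  `W` of it is `W(u_0,…,u_{k-2}, s) = W_k` (column operation `s = u_{k-1} + Σ_{i<k-1} u_i`), so
  `top W_k = top W_{k-1} + top s` (then `j = k-1`).  Checked exactly on 4 000 random/adversarial families
  (folder `kit/vdp_structure_check.py`, 0 failures).
* CHART PAIR COUNT (`stub_chartPairCount`): in an affine chart of directions `w = (σ, t)`, `σ = ±1`, the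
  number of pairs `(top_w G, top_w F)` realised at generic `t` is `≤ V(F) + V(G)` — tops are vertices
  (strictly exposed ⇒ extreme), and `t ↦ top_t F` has interval fibres (monotone sweep), so along increasing
  `t` the pair changes at most `(#tops F - 1) + (#tops G - 1)` times.
* VERTEX CHARTS (`stub_vertexCharts`): every vertex of `Newt(s)` is the strict top of `s` for a generic weight
  with `w₀ = ±1` (strict exposure by a real form, perturbed to `w₁/w₀ ∉ ℚ`, rescaled), so
  `V(s) ≤ #tops(chart +1) + #tops(chart -1)`.
* ASSEMBLY (`stub_vdpAssembly`, lead): reduce to a ℂ-independent sub-family carrying `s` with nonzero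
  coefficients (scalars move neither supports nor — up to a unit of `ℂ[μ]` — Wronskians), then
  `V(s) ≤ Σ_{σ=±1} #tops_σ(s) ≤ Σ_σ Σ_{j<k} #pairs_σ(W_{j+1}, W_j) ≤ 2 Σ_{j<k} (V W_{j+1} + V W_j) ≤ 4k·max`,
  i.e. `Vdp` with `c = 4`.
* `stub_productVertices` restated in chart form `V(Π_{j<m} f_j) ≤ 2mt + 2` (the sharp Ostrowski count `mt`
  needs a full-circle sweep; the composition only needs linear in `mt`).
* `stub_wronskianWeak`: verbatim (the residual; the lead holds it).

Composition (sorry-free): `NewtonTauWeak_of` = `newtonTauWeak_of_hyps` (constants `a' = a+2`,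
`b' = b+c+4`) fed with the stubs; `NewtonTauWeak_of_stubs : NewtonTauWeak`.

## Disproof used (`Cruxes/NewtonTauWeak/Disproof.lean` v6; landed `Negative/Zonogon`, `MatrixTransfer`,
`LoadBearing`): §A sparsity load-bearing — `t` enters via `stub_productVertices` and `stub_wronskianWeak`;
§B/§C `k`, `t`, `m` indispensable — the composed bound keeps `2^{(a+2)m}`, `(kt+2)^{…}`; the zonogon
`zProd m` (`two_mul_le_vert_zProd`) is the tightness witness for `stub_productVertices` at `t = 2` and shows
`a ≥ 1` is needed in `stub_wronskianWeak` already at `r = 2` (`W(1, zProd m) = θ zProd m`, `≥ 2m-1`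
vertices); no `-- Targets` entry of the Disproof concerns this line's stubs (v6); §N1/N2 kill targets
(VP shadows / 2×2 matrix products) would, through `Vdp`, locate any explosion inside some flag Wronskian.
-/

set_option linter.dupNamespace false

noncomputable section

namespace Summit.ValiantsHypothesis.ValiantsHypothesis.Cruxes.NewtonTauWeak.EulerWronskianVdp

open scoped BigOperators Polynomial
open MvPolynomial
open Literature.Computability.AlgebraicComplexity (newtonVertexCount)
open Summit.ValiantsHypothesis.ValiantsHypothesis.Theorems.NewtonTauWeakVdp

/-! ## Named statements of the line (Props over the tree's `…Theorems.NewtonTauWeakVdp` objects) -/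

/-- LEADING TERM of an Euler–Wronskian whose columns have pairwise distinct strict tops. -/
def LeadingTermWronskian : Prop :=
  ∀ (r : ℕ) (v : Fin r → MvPolynomial (Fin 2) ℂ) (w : Fin 2 → ℝ), IsGeneric w →
    ∀ (e : Fin r → (Fin 2 →₀ ℕ)), (∀ b, IsTop w (v b) (e b)) → Function.Injective e →
      IsTop w (eulerWronskian fun b => baseChange (v b)) (∑ b, e b)

/-- STRUCTURE of the top of a sum of an independent family: it is a difference of consecutive flag tops. -/
def VdpStructure : Prop :=
  ∀ (k : ℕ) (u : Fin k → MvPolynomial (Fin 2) ℂ), LinearIndependent ℂ u →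
    ∀ (w : Fin 2 → ℝ), IsGeneric w → ∀ (e : Fin 2 →₀ ℕ), IsTop w (∑ i, u i) e →
      ∃ (j : Fin k) (a b : Fin 2 →₀ ℕ),
        IsTop w (flagW u (Fin.castSucc j)) a ∧ IsTop w (flagW u j.succ) b ∧ e + a = b

/-- CHART PAIR COUNT: realised pairs of tops along an affine chart of directions. -/
def ChartPairCount : Prop :=
  ∀ (σ : ℝ), (σ = 1 ∨ σ = -1) → ∀ (F G : MvPolynomial (Fin 2) Slope),
    {ab : (Fin 2 →₀ ℕ) × (Fin 2 →₀ ℕ) |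
        ∃ t : ℝ, IsGeneric ![σ, t] ∧ IsTop ![σ, t] G ab.1 ∧ IsTop ![σ, t] F ab.2}.ncard ≤
      newtonVertexCount F + newtonVertexCount G

/-- VERTEX CHARTS: every vertex is a generic top in one of the two affine charts. -/
def VertexCharts : Prop :=
  ∀ (s : MvPolynomial (Fin 2) ℂ),
    newtonVertexCount s ≤
      {e : Fin 2 →₀ ℕ | ∃ t : ℝ, IsGeneric ![(1 : ℝ), t] ∧ IsTop ![(1 : ℝ), t] s e}.ncard +
        {e : Fin 2 →₀ ℕ | ∃ t : ℝ, IsGeneric ![(-1 : ℝ), t] ∧ IsTop ![(-1 : ℝ), t] s e}.ncard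

/-- `Vdp` — ultrametric Voorhoeve–van der Poorten at polynomial level (the planner's `stub_vdp` verbatim). -/
def Vdp : Prop :=
  ∃ c : ℕ, ∀ (k : ℕ) (u : Fin k → MvPolynomial (Fin 2) ℂ),
    newtonVertexCount (∑ i, u i) ≤ c * (k + 1) ^ 2 * wronskianSup u

/-- Chart form of Ostrowski's single-product bound. -/
def ProductVertices : Prop :=
  ∀ (m t : ℕ) (f : Fin m → MvPolynomial (Fin 2) ℂ), (∀ j, (f j).support.card ≤ t) →
    newtonVertexCount (∏ j, f j) ≤ 2 * m * t + 2

/-- The residual: Euler–Wronskians of `r ≥ 2` products are small, uniformly in `r`. -/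
def WronskianWeak : Prop :=
  ∃ a b : ℕ, ∀ (r m t : ℕ) (f : Fin r → Fin m → MvPolynomial (Fin 2) ℂ),
    (∀ i j, (f i j).support.card ≤ t) → 2 ≤ r →
      newtonVertexCount (eulerWronskian fun b => baseChange (∏ j, f b j)) ≤
        2 ^ (a * m) * (r * t + 2) ^ b

/-! ## Registered stubs (`sorry` lives only here; statements inlined over tree declarations) -/

/-- STUB A (M/L, provable) — **leading term of the Euler–Wronskian.**  If `v_0,…,v_{r-1} ∈ ℂ[X,Y]` have
strict `w`-tops `e_0,…,e_{r-1}` which are pairwise distinct, then `W(v) = det[θ^a v_b]_{a,b<r}` has strict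
`w`-top `Σ_b e_b`.  Proof: `θ^a(baseChange v_b) = Σ_{f ∈ supp v_b} monomial f (⟨ν,f⟩^a · C(coeff_f v_b))`
(`euler_iterate_monomial`, `coeff_euler_iterate`); expand `det` (`Matrix.det_apply'` + `Finset.prod_univ_sum`)
as `Σ_{φ ∈ Π_b supp v_b} (Π_b C coeff_{φ b}) · det[⟨ν,φ b⟩^a] · X^{Σ_b φ b}`; for `φ ≠ e`,
`wdeg(Σφ) < wdeg(Σe)` (`IsTop.lt`, `wdeg_sum`); the `φ = e` coefficient is
`(Π_b coeff_{e_b} v_b) · det(vandermonde (⟨ν,e_b⟩)_b)ᵀ ≠ 0` (`Matrix.det_vandermonde`, `eulerWeight_injective`,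
`ℂ[μ]` a domain).  `r = 0`: `W = 1`, top `0`. [KPT arXiv:1205.1015 §2 (real analogue); folklore] -/
theorem stub_leadingTermWronskian :
    ∀ (r : ℕ) (v : Fin r → MvPolynomial (Fin 2) ℂ) (w : Fin 2 → ℝ), IsGeneric w →
      ∀ (e : Fin r → (Fin 2 →₀ ℕ)), (∀ b, IsTop w (v b) (e b)) → Function.Injective e →
        IsTop w (eulerWronskian fun b => baseChange (v b)) (∑ b, e b) := by
  sorry

/-- STUB B (L, provable) — **structure of the top of a sum** (from STUB A's statement, taken as the
hypothesis `hLT`): for a ℂ-linearly-independent `u : Fin k → ℂ[X,Y]`, a generic `w` and the strict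
`w`-top `e` of `Σ_i u_i`, there is `j < k` with `e + top(W_j) = top(W_{j+1})`, `W_j = flagW u j`.
Proof: see the module docstring (min-top coset representatives `ũ_i ∈ u_i + span(u_{<i})` with pairwise
distinct tops; `W(ũ_{<j}) = W(u_{<j})` by unipotent column operations — `Matrix.det_mul`,
`Matrix.det_of_upperTriangular`, `euler_iterate_add/smul`; tops of all `W_j` from `hLT`; case split on
whether `e` is one of the `top ũ_i`, `i < k-1`; in the other case apply `hLT` to `(ũ_0,…,ũ_{k-2}, Σu)`,
whose Wronskian is `W_k`).  `k = 0` is vacuous (`Σu = 0` has no top). [KPT arXiv:1205.1015 Thm 7 (real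
analogue); folklore] -/
theorem stub_vdpStructure
    (hLT : ∀ (r : ℕ) (v : Fin r → MvPolynomial (Fin 2) ℂ) (w : Fin 2 → ℝ), IsGeneric w →
      ∀ (e : Fin r → (Fin 2 →₀ ℕ)), (∀ b, IsTop w (v b) (e b)) → Function.Injective e →
        IsTop w (eulerWronskian fun b => baseChange (v b)) (∑ b, e b)) :
    ∀ (k : ℕ) (u : Fin k → MvPolynomial (Fin 2) ℂ), LinearIndependent ℂ u →
      ∀ (w : Fin 2 → ℝ), IsGeneric w → ∀ (e : Fin 2 →₀ ℕ), IsTop w (∑ i, u i) e →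
        ∃ (j : Fin k) (a b : Fin 2 →₀ ℕ),
          IsTop w (flagW u (Fin.castSucc j)) a ∧ IsTop w (flagW u j.succ) b ∧ e + a = b := by
  sorry

/-- STUB C (M, provable) — **chart pair count.**  Fix `σ = ±1` and `F, G ∈ ℂ[μ][X,Y]`.  Along the chart
`w_t = (σ, t)`, `t ∈ ℝ`, the set of realised pairs `(top_{w_t} G, top_{w_t} F)` (over generic `t`) has at
most `V(F) + V(G)` elements.  Proof: (i) a strict top for `w_t` is a vertex: `mem_extremePoints_convexHull_of_linear`
(Literature…NewtonPolygonTauTransfer) with the linear form `x ↦ σ x₀ + t x₁`, and distinct exponents give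
distinct points, so `#{tops of F along the chart} ≤ V(F)`; (ii) interval fibres: if `b` is the top of `F` at
`t₁ < t₂ < t₃`… precisely at `t₁` and `t₃` then also at `t₂` (`wdeg (σ,t) e = σe₀ + te₁` is affine in `t`);
(iii) hence along increasing `t` each component is a non-returning sequence and the pair changes at most
`(#tops F - 1) + (#tops G - 1)` times: `#pairs ≤ #tops F + #tops G - 1` (empty if `F = 0` or `G = 0`). [folklore] -/
theorem stub_chartPairCount :
    ∀ (σ : ℝ), (σ = 1 ∨ σ = -1) → ∀ (F G : MvPolynomial (Fin 2) Slope),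
      {ab : (Fin 2 →₀ ℕ) × (Fin 2 →₀ ℕ) |
          ∃ t : ℝ, IsGeneric ![σ, t] ∧ IsTop ![σ, t] G ab.1 ∧ IsTop ![σ, t] F ab.2}.ncard ≤
        newtonVertexCount F + newtonVertexCount G := by
  sorry

/-- STUB D (M, provable) — **vertex charts.**  Every vertex of `Newt(s)` is `emb e` for an exponent `e` that
is the strict top of `s` for some GENERIC weight `(1, t)` or `(-1, t)`.  Proof: a vertex is strictly exposed by
a real form `ξ` (`TwoProducts.Exposure.exists_real_form_of_mem_extremePoints`, negate for a maximiser); on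
the finite support the exposure survives a small perturbation, so take `w` near `ξ` with `w₀ ∈ ℚ ∖ {0}` and
`w₁ ∉ ℚ` (dense), which is generic (`w₀ a + w₁ b = 0`, `a b : ℤ` forces `a = b = 0`); rescale by `|w₀|⁻¹ > 0`
(`IsTop.smul_pos`, `IsGeneric.smul`).  Then `extremePoints ⊆ emb '' (T₊ ∪ T₋)` and `ncard` is subadditive. [folklore] -/
theorem stub_vertexCharts :
    ∀ (s : MvPolynomial (Fin 2) ℂ),
      newtonVertexCount s ≤
        {e : Fin 2 →₀ ℕ | ∃ t : ℝ, IsGeneric ![(1 : ℝ), t] ∧ IsTop ![(1 : ℝ), t] s e}.ncard +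
          {e : Fin 2 →₀ ℕ | ∃ t : ℝ, IsGeneric ![(-1 : ℝ), t] ∧ IsTop ![(-1 : ℝ), t] s e}.ncard := by
  sorry

/-- STUB E (L, lead) — **assembly of `Vdp`** from STUBS B–D (taken as hypotheses): reduce an arbitrary
family to a ℂ-independent sub-family `(λ_i u_i)_{i ∈ B}` with the same sum and all `λ_i ≠ 0`
(`exists_linearIndependent` + drop zero coefficients); its flag Wronskians are `(Π λ) • W(u_T)` for initial
segments `T` of `B` (column scaling, `Matrix.det_mul_column`; `Finset.orderEmbOfFin_unique`), with the same
vertex counts (`ℂ[μ]` is a domain); then `V(s) ≤ #T₊ + #T₋` (D), `T_σ ⊆ ⋃_{j<k'} {b - a : (a,b) ∈ pairs_σ(W_{j+1}, W_j)}`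
(B), `#pairs_σ ≤ V(W_{j+1}) + V(W_j) ≤ 2·wronskianSup u` (C): `V(s) ≤ 4k·wronskianSup u ≤ 4(k+1)²·wronskianSup u`. -/
theorem stub_vdpAssembly
    (hS : ∀ (k : ℕ) (u : Fin k → MvPolynomial (Fin 2) ℂ), LinearIndependent ℂ u →
      ∀ (w : Fin 2 → ℝ), IsGeneric w → ∀ (e : Fin 2 →₀ ℕ), IsTop w (∑ i, u i) e →
        ∃ (j : Fin k) (a b : Fin 2 →₀ ℕ),
          IsTop w (flagW u (Fin.castSucc j)) a ∧ IsTop w (flagW u j.succ) b ∧ e + a = b)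
    (hC : ∀ (σ : ℝ), (σ = 1 ∨ σ = -1) → ∀ (F G : MvPolynomial (Fin 2) Slope),
      {ab : (Fin 2 →₀ ℕ) × (Fin 2 →₀ ℕ) |
          ∃ t : ℝ, IsGeneric ![σ, t] ∧ IsTop ![σ, t] G ab.1 ∧ IsTop ![σ, t] F ab.2}.ncard ≤
        newtonVertexCount F + newtonVertexCount G)
    (hV : ∀ (s : MvPolynomial (Fin 2) ℂ),
      newtonVertexCount s ≤
        {e : Fin 2 →₀ ℕ | ∃ t : ℝ, IsGeneric ![(1 : ℝ), t] ∧ IsTop ![(1 : ℝ), t] s e}.ncard +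
          {e : Fin 2 →₀ ℕ | ∃ t : ℝ, IsGeneric ![(-1 : ℝ), t] ∧ IsTop ![(-1 : ℝ), t] s e}.ncard) :
    ∃ c : ℕ, ∀ (k : ℕ) (u : Fin k → MvPolynomial (Fin 2) ℂ),
      newtonVertexCount (∑ i, u i) ≤ c * (k + 1) ^ 2 * wronskianSup u := by
  sorry

/-- STUB F (M, provable) — **Ostrowski / KPTT §2, chart form** (from STUB D's statement, taken as the
hypothesis `hV`).  `V(Π_{j<m} f_j) ≤ 2mt + 2` for `t`-sparse `f_j`.  Proof (chart method, no Minkowski theory): if some `f_j = 0` the product is `0`; else for a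
generic weight `w` the strict top of `Π f_j` is `Σ_j top_w f_j` (domain: the top coefficients multiply to a
nonzero product, every other exponent tuple has smaller `wdeg`); by the vertex-charts argument (as in STUB D)
`V ≤ #T₊ + #T₋`, and along each chart `t ↦ (top_t f_j)_j` is a tuple of non-returning sequences
(interval fibres), so `#T_σ ≤ 1 + Σ_j (#tops f_j - 1) ≤ 1 + m(t-1)`; total `≤ 2 + 2m(t-1) ≤ 2mt + 2`.
(`m = 0`: `V(1) ≤ 1`.)  The sharp bound `mt` (tight: `two_mul_le_vert_zProd`) needs a full-circle sweep
and is not required by the composition. [KPTT arXiv:1308.2286 §2; Ostrowski; folklore] -/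
theorem stub_productVertices
    (hV : ∀ (s : MvPolynomial (Fin 2) ℂ),
      newtonVertexCount s ≤
        {e : Fin 2 →₀ ℕ | ∃ t : ℝ, IsGeneric ![(1 : ℝ), t] ∧ IsTop ![(1 : ℝ), t] s e}.ncard +
          {e : Fin 2 →₀ ℕ | ∃ t : ℝ, IsGeneric ![(-1 : ℝ), t] ∧ IsTop ![(-1 : ℝ), t] s e}.ncard) :
    ∀ (m t : ℕ) (f : Fin m → MvPolynomial (Fin 2) ℂ), (∀ j, (f j).support.card ≤ t) →
      newtonVertexCount (∏ j, f j) ≤ 2 * m * t + 2 := by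
  sorry

/-- STUB G (OPEN, hardest, lead) — **the residual `WronskianWeak`** (verbatim from the crux-plan): the
Euler–Wronskian of `r ≥ 2` products of `m` `t`-sparse bivariate polynomials has `≤ 2^{am}(rt+2)^b`
Newton vertices, `a, b` independent of `r`.  By multilinearity the support is the planar image `S ↦ ΣS` of
the bases of the rank-`r` column matroid of the coefficient matrix weighted by `det·VdM`; generic case =
`r`-set polygon of the sumset `A_1+⋯+A_m` (measured `≤ 0.9·rmt`, kit j014181); each FIXED `r` is implied by
the crux; uniformity in `r` is the bet; designs dug `≤ +2` vertices (j014320).  Why it might fail: designed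
coefficients impose Vandermonde-weighted unit equations `Σ_{S:ΣS=E} det(C_S)VdM_S(μ) = 0` that could dig a
long convex chain out of a digit frame. [KPTT arXiv:1308.2286; KPT arXiv:1205.1015; Dey 1998] -/
theorem stub_wronskianWeak :
    ∃ a b : ℕ, ∀ (r m t : ℕ) (f : Fin r → Fin m → MvPolynomial (Fin 2) ℂ),
      (∀ i j, (f i j).support.card ≤ t) → 2 ≤ r →
        newtonVertexCount (eulerWronskian fun b => baseChange (∏ j, f b j)) ≤
          2 ^ (a * m) * (r * t + 2) ^ b := by
  sorry

/-! ## Consistency: each named statement IS its registered stub -/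

theorem leadingTermWronskian_holds : LeadingTermWronskian := stub_leadingTermWronskian
theorem vdpStructure_holds : VdpStructure := stub_vdpStructure stub_leadingTermWronskian
theorem chartPairCount_holds : ChartPairCount := stub_chartPairCount
theorem vertexCharts_holds : VertexCharts := stub_vertexCharts
theorem vdp_holds : Vdp := stub_vdpAssembly vdpStructure_holds chartPairCount_holds vertexCharts_holds
theorem productVertices_holds : ProductVertices := stub_productVertices stub_vertexCharts
theorem wronskianWeak_holds : WronskianWeak := stub_wronskianWeak

/-! ## Name-keyed alias of the open residual (the hypothesis of `NewtonTauWeak_of`) -/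
namespace Registered

/-- Alias of `WronskianWeak` keyed by the registered stub name. -/
abbrev stub_wronskianWeak : Prop := WronskianWeak

end Registered

/-! ## Composition (sorry-free): the stubs imply the crux BY NAME -/

/-- Arithmetic: `2^{m+1}(kt+2) ≤ 2^{2m}(kt+2)^2`. -/
theorem two_pow_succ_mul_le (m n : ℕ) (hn : 2 ≤ n) : 2 ^ (m + 1) * n ≤ 2 ^ (2 * m) * n ^ 2 := by
  cases m with
  | zero =>
    calc 2 ^ (0 + 1) * n = 2 * n := by ring
      _ ≤ n * n := Nat.mul_le_mul_right n hn
      _ = 2 ^ (2 * 0) * n ^ 2 := by ring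
  | succ m =>
    have h1 : 2 ^ (m + 1 + 1) ≤ 2 ^ (2 * (m + 1)) := Nat.pow_le_pow_right (by norm_num) (by omega)
    have h2 : n ≤ n ^ 2 := by nlinarith
    exact Nat.mul_le_mul h1 h2

/-- **The line closes the crux (hypothesis form).**  `Vdp`, `ProductVertices` and `WronskianWeak` give
`NewtonUnitEquations.NewtonTauWeak` with constants `a' = a + 2`, `b' = b + c + 4`:
`V(Σ_iΠ_j f_ij) ≤ c(k+1)²·max_S V(W(u_S))`, and every `W(u_S)` is `1` (`S = ∅`), a single product
(`|S| = 1`: `≤ 2mt+2 ≤ 2^{2m}(kt+2)^2`) or is bounded by the residual (`|S| ≥ 2`); `t = 0` is treated apart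
(then every `f_ij = 0`). -/
theorem newtonTauWeak_of_hyps (hvdp : Vdp) (hprod : ProductVertices) (hw : WronskianWeak) :
    Summit.ValiantsHypothesis.ValiantsHypothesis.Theses.NewtonUnitEquations.NewtonTauWeak := by
  obtain ⟨c, hc⟩ := hvdp
  obtain ⟨a, b, hw⟩ := hw
  refine ⟨a + 2, b + c + 4, ?_⟩
  intro k m t f hf
  -- the crux's vertex count is `newtonVertexCount` by `rfl`
  show newtonVertexCount (∑ i, ∏ j, f i j) ≤ 2 ^ ((a + 2) * m) * (k * t + 2) ^ (b + c + 4)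
  have hpos : 0 < 2 ^ ((a + 2) * m) * (k * t + 2) ^ (b + c + 4) := by positivity
  by_cases ht : t = 0
  · -- degenerate corner: every `f i j` vanishes
    subst ht
    have hf0 : ∀ i j, f i j = 0 := fun i j => by
      have h := hf i j
      rw [Nat.le_zero, Finset.card_eq_zero, support_eq_empty] at h
      exact h
    cases m with
    | zero =>
      have hsum : (∑ i : Fin k, ∏ j : Fin 0, f i j) = monomial 0 (k : ℂ) := by simp
      rw [hsum]
      calc newtonVertexCount (monomial (0 : Fin 2 →₀ ℕ) (k : ℂ))
          ≤ (monomial (0 : Fin 2 →₀ ℕ) (k : ℂ)).support.card := newtonVertexCount_le_card_support _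
        _ ≤ 1 := (Finset.card_le_card support_monomial_subset).trans (by simp)
        _ ≤ _ := hpos
    | succ m =>
      have hsum : (∑ i : Fin k, ∏ j : Fin (m + 1), f i j) = 0 := by
        refine Finset.sum_eq_zero fun i _ => ?_
        exact Finset.prod_eq_zero (Finset.mem_univ 0) (hf0 i 0)
      rw [hsum, newtonVertexCount_zero]
      exact Nat.zero_le _
  · have ht1 : 1 ≤ t := Nat.one_le_iff_ne_zero.mpr ht
    set u : Fin k → MvPolynomial (Fin 2) ℂ := fun i => ∏ j, f i j with hu
    have hkt : k + 1 ≤ k * t + 2 := by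
      have : k ≤ k * t := Nat.le_mul_of_pos_right k ht1
      omega
    have hbase : 2 ≤ k * t + 2 := by omega
    -- every Euler–Wronskian of a sub-family is small
    have hsup : wronskianSup u ≤ 2 ^ ((a + 2) * m) * (k * t + 2) ^ (b + 2) := by
      unfold wronskianSup
      refine Finset.sup_le fun T _ => ?_
      have hB : 0 < 2 ^ ((a + 2) * m) * (k * t + 2) ^ (b + 2) := by positivity
      rcases Nat.lt_or_ge T.card 2 with hlt | hge
      · rcases Nat.lt_or_ge T.card 1 with h0 | h1
        · -- empty sub-family: `W = 1`
          have hT : T.card = 0 := by omega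
          rw [eulerWronskian_of_eq_zero hT]
          exact newtonVertexCount_one_le.trans hB
        · -- one product: Ostrowski (chart form)
          have hT : T.card = 1 := by omega
          rw [eulerWronskian_of_eq_one hT, newtonVertexCount_baseChange]
          set i₀ : Fin k := T.orderEmbOfFin rfl ⟨0, by omega⟩ with hi₀
          have hk : 1 ≤ k := Fin.pos i₀
          have h1 : newtonVertexCount (u i₀) ≤ 2 * m * t + 2 := hprod m t (f i₀) (hf i₀)
          have hm : m ≤ 2 ^ m := (Nat.lt_two_pow_self).le
          have h2 : 2 * m * t + 2 ≤ 2 ^ (m + 1) * (k * t + 2) := by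
            have h21 : m * t ≤ 2 ^ m * (k * t) := by
              calc m * t ≤ 2 ^ m * t := Nat.mul_le_mul_right t hm
                _ ≤ 2 ^ m * (k * t) := Nat.mul_le_mul_left _ (Nat.le_mul_of_pos_left t hk)
            calc 2 * m * t + 2 = 2 * (m * t) + 2 := by ring
              _ ≤ 2 * (2 ^ m * (k * t)) + 2 * (2 ^ m * 2) := by
                  have : 1 ≤ 2 ^ m := Nat.one_le_two_pow
                  nlinarith
              _ = 2 ^ (m + 1) * (k * t + 2) := by ring
          have h3 : 2 ^ (m + 1) * (k * t + 2) ≤ 2 ^ ((a + 2) * m) * (k * t + 2) ^ (b + 2) := by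
            calc 2 ^ (m + 1) * (k * t + 2) ≤ 2 ^ (2 * m) * (k * t + 2) ^ 2 :=
                  two_pow_succ_mul_le m _ hbase
              _ ≤ 2 ^ ((a + 2) * m) * (k * t + 2) ^ (b + 2) := by
                  apply Nat.mul_le_mul
                  · exact Nat.pow_le_pow_right (by norm_num) (by nlinarith)
                  · exact Nat.pow_le_pow_right (by omega) (by omega)
          exact h1.trans (h2.trans h3)
      · -- at least two products: the residual
        have hTk : T.card ≤ k := by
          simpa using Finset.card_le_univ T
        have h1 := hw T.card m t (fun b j => f (T.orderEmbOfFin rfl b) j) (fun i j => hf _ _) hge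
        refine h1.trans ?_
        apply Nat.mul_le_mul
        · exact Nat.pow_le_pow_right (by norm_num) (by nlinarith)
        · calc (T.card * t + 2) ^ b ≤ (k * t + 2) ^ b :=
              Nat.pow_le_pow_left (by nlinarith [Nat.mul_le_mul_right t hTk]) b
            _ ≤ (k * t + 2) ^ (b + 2) := Nat.pow_le_pow_right (by omega) (by omega)
    -- assemble
    have hmain := hc k u
    have hc2 : c ≤ (k * t + 2) ^ c :=
      (Nat.lt_two_pow_self).le.trans (Nat.pow_le_pow_left (by omega) c)
    have hk2 : (k + 1) ^ 2 ≤ (k * t + 2) ^ 2 := Nat.pow_le_pow_left hkt 2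
    calc newtonVertexCount (∑ i, ∏ j, f i j) = newtonVertexCount (∑ i, u i) := rfl
      _ ≤ c * (k + 1) ^ 2 * wronskianSup u := hmain
      _ ≤ c * (k + 1) ^ 2 * (2 ^ ((a + 2) * m) * (k * t + 2) ^ (b + 2)) :=
          Nat.mul_le_mul_left _ hsup
      _ = 2 ^ ((a + 2) * m) * ((c * (k + 1) ^ 2) * (k * t + 2) ^ (b + 2)) := by ring
      _ ≤ 2 ^ ((a + 2) * m) * (((k * t + 2) ^ c * (k * t + 2) ^ 2) * (k * t + 2) ^ (b + 2)) := by
          apply Nat.mul_le_mul_left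
          apply Nat.mul_le_mul_right
          exact Nat.mul_le_mul hc2 hk2
      _ = 2 ^ ((a + 2) * m) * (k * t + 2) ^ (b + c + 4) := by ring

/-- **The line closes the crux modulo the open residual** (all other stubs are applied inside; they are
provable and delegated/landing). -/
theorem NewtonTauWeak_of (h : Registered.stub_wronskianWeak) :
    Summit.ValiantsHypothesis.ValiantsHypothesis.Theses.NewtonUnitEquations.NewtonTauWeak :=
  newtonTauWeak_of_hyps vdp_holds productVertices_holds h

/-- The composition instantiated with every registered stub (audit: the crux BY NAME from `stub_*` only). -/
theorem NewtonTauWeak_of_stubs :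
    Summit.ValiantsHypothesis.ValiantsHypothesis.Theses.NewtonUnitEquations.NewtonTauWeak :=
  NewtonTauWeak_of stub_wronskianWeak

end Summit.ValiantsHypothesis.ValiantsHypothesis.Cruxes.NewtonTauWeak.EulerWronskianVdp

end
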